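import Mathlib
import HarnessLib
import Literature.MathematicalPhysics.QuantumLattice.HubbardUVGridPieceMoment

/-!
# The first SPACE moment of a piece from the mixed `ℓ²` table restricted to the orders actually used (`a ≤ 2`, `b ≤ 1`)

Topic `MathematicalPhysics/QuantumLattice`; a restatement of `HubbardUVGridPieceMoment.sum_sum_spaceWeight_mul_norm_charSum_le` /
`spaceMoment_charSum_piece_le` (k3c2-p1) with the hypothesis on the compact `ℓ²` table `Σ‖Δ_u^tΔ_{e_l}^aΔ_{e_{l'}}^b P‖² ≤ Kq(t,a+b)/…`
asked only for the orders the weighted Plancherel inequality with the monomial `|b̃_l|` and the product weight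
`(1+(ã/R₀)²)(1+(b̃_l/R)²)(1+(b̃_{l'}/R)²)` consumes — `t ≤ 1`, `1 ≤ a ≤ 2`, `b ≤ 1` — instead of all `a + b ≤ 3`.  The proofs are
those of the originals verbatim.  Reason: for the scale-`0` sector MULTIPLIERS of Benfatto–Giuliani–Mastropietro 2006, §2.5
(2.45)–(2.48), the table is supplied by CENTRED sampling (`TorusCentredSampling.norm_fwdDiff_iter₂_centred_le`,
`HubbardSymbolCentredComposition`), which is valid for at most two steps per direction (`a, b ≤ 2`), so the pure third differences
`(3,0)`, `(0,3)` of the original hypothesis are not available — and not needed.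

* **`sum_sum_spaceWeight_mul_norm_charSum_le_of_orders`**, **`spaceMoment_charSum_piece_le_of_orders`**.

Everything is proved; no definitions, no named facts.

## Sources

G. Benfatto, A. Giuliani, V. Mastropietro, Ann. Henri Poincaré 7 (2006) 809–898, §2.1 Lemma 2.2, (2.36aa), §2.8 (2.80)–(2.81),
§3 (3.2)–(3.8) (`BenfattoGiulianiMastropietro2006`).
-/

noncomputable section

namespace Literature.MathematicalPhysics.QuantumLattice

open Literature.Probability.LatticeModels Finset Complex

variable {L M N : ℕ}

section Moment

variable [NeZero L] [NeZero N] {β Λ : ℝ}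

/-- **The first SPACE moment at integer scales `R₀, R ≥ 1`**: for a piece `P` whose differenced `ℓ²` norms obey the compact table
`Σ‖Δ_u^tΔ_{e_l}^aΔ_{e_{l'}}^b P‖² ≤ Kq(t,a+b)/(L^{2(a+b)+2}β^{2t+1})` (only the orders USED: `t ≤ 1`, `1 ≤ a ≤ 2`, `b ≤ 1` — so that CENTRED sampling, valid up to two steps per direction, can supply the table), with `Y = 4|b̃_l|/L`,
`Σ_{a,b⃗} Y·‖S[P](a,b⃗)‖ ≤ √(216·R₀·R²)·(1/L)·√(N·Σ_e (N/(4R₀))^{2e₀}(1/(4R))^{2(e₁+e₂)}·Kq(e₀,1+e₁+e₂)/β^{2e₀+1})`.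
[cite: BenfattoGiulianiMastropietro2006, Lemma 2.2, (2.36aa) and (3.3)] -/
theorem sum_sum_spaceWeight_mul_norm_charSum_le_of_orders (hβ : 0 < β) (P : TorusSite 1 N → TorusSite 2 L → ℂ) (Kq : ℕ → ℕ → ℝ)
    (hKq : ∀ t k, 0 ≤ Kq t k) {l l' : Fin 2} (hll' : l ≠ l')
    (hS : ∀ (t a b : ℕ), t ≤ 1 → 1 ≤ a + b → a ≤ 2 → b ≤ 1 →
      ∑ p : TorusSite 1 N, ∑ p' : TorusSite 2 L,
          ‖(fwdDiff (fun _ : Fin 1 => (1 : ZMod N)))^[t]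
            (fun q => (fwdDiff (Pi.single l (1 : ZMod L) : TorusSite 2 L))^[a]
              ((fwdDiff (Pi.single l' (1 : ZMod L) : TorusSite 2 L))^[b] (P q)) p') p‖ ^ 2 ≤
        Kq t (a + b) / ((L : ℝ) ^ (2 * (a + b) + 2) * β ^ (2 * t + 1)))
    {R₀ R : ℕ} (hR₀ : 1 ≤ R₀) (hR : 1 ≤ R) :
    ∑ a : TorusSite 1 N, ∑ bv : TorusSite 2 L,
        4 * |(((bv l).valMinAbs : ℤ) : ℝ)| / L *
          ‖∑ q₀ : TorusSite 1 N, ∑ qv : TorusSite 2 L, torusChar q₀ a * torusChar qv bv * P q₀ qv‖ ≤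
      Real.sqrt (216 * R₀ * (R : ℝ) ^ 2) *
        Real.sqrt ((N : ℝ) / (L : ℝ) ^ 2 * ∑ e : Fin 2 × Fin 2 × Fin 2,
          (((N : ℝ) / (4 * R₀)) ^ 2) ^ (e.1 : ℕ) * ((1 / (4 * (R : ℝ))) ^ 2) ^ ((e.2.1 : ℕ) + (e.2.2 : ℕ)) *
            (Kq (e.1 : ℕ) (1 + (e.2.1 : ℕ) + (e.2.2 : ℕ)) / β ^ (2 * (e.1 : ℕ) + 1))) := by
  have hprod : ∀ b : TorusSite 2 L, (1 + (((b l).valMinAbs : ℝ) / R) ^ 2) * (1 + (((b l').valMinAbs : ℝ) / R) ^ 2) =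
      ∏ i : Fin 2, (1 + (((b i).valMinAbs : ℝ) / R) ^ 2) := by
    intro b
    rw [Fin.prod_univ_two]
    fin_cases l <;> fin_cases l' <;> simp_all [mul_comm]
  have hL : (0 : ℝ) < L := by exact_mod_cast Nat.pos_of_ne_zero (NeZero.ne L)
  have hNpos : (0 : ℝ) < N := by exact_mod_cast Nat.pos_of_ne_zero (NeZero.ne N)
  have hR0r : (0 : ℝ) < R₀ := by exact_mod_cast hR₀
  have hRr : (0 : ℝ) < R := by exact_mod_cast hR
  set c₀ : ℝ := ((N : ℝ) / (4 * R₀)) ^ 2 with hc₀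
  set cX : ℝ := ((L : ℝ) / (4 * R)) ^ 2 with hcX
  have hP := sum_sum_monomial_mul_norm_prodChar_le_prodWeight (d₁ := 1) (L₁ := N) (d₂ := 2) (L₂ := L) P
    (fun _ : Fin 1 => (1 : ZMod N)) (Pi.single l (1 : ZMod L) : TorusSite 2 L) (Pi.single l' (1 : ZMod L) : TorusSite 2 L)
    0 1 0 1 1 1 (c₀ := c₀) (c₁ := cX) (c₂ := cX) (by positivity) (by positivity) (by positivity)
  have h1 : ∀ a : TorusSite 1 N, (∑ j, (fun _ : Fin 1 => (1 : ZMod N)) j * a j) = a 0 := fun a => by simp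
  have h2 : ∀ (i : Fin 2) (b : TorusSite 2 L), (∑ j, (Pi.single i (1 : ZMod L) : TorusSite 2 L) j * b j) = b i := by
    intro i b; simp [Pi.single_apply]
  simp only [h1, h2] at hP
  simp only [pow_one, pow_zero, mul_one, one_mul, zero_add] at hP
  refine hP.trans (mul_le_mul ?_ ?_ (Real.sqrt_nonneg _) (Real.sqrt_nonneg _))
  · -- the inverse weight sum factorises: `≤ 6R₀ · 36R²`
    refine Real.sqrt_le_sqrt ?_
    have hrw : ∀ (a : TorusSite 1 N) (b : TorusSite 2 L),
        ((1 + c₀ * (4 * |((a 0).valMinAbs : ℝ)| / N) ^ 2) *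
          (1 + cX * (4 * |((b l).valMinAbs : ℝ)| / L) ^ 2) * (1 + cX * (4 * |((b l').valMinAbs : ℝ)| / L) ^ 2))⁻¹ =
          ((1 + (((a 0).valMinAbs : ℝ) / R₀) ^ 2) *
            ((1 + (((b l).valMinAbs : ℝ) / R) ^ 2) * (1 + (((b l').valMinAbs : ℝ) / R) ^ 2)))⁻¹ := by
      intro a b
      have hNne : (N : ℝ) ≠ 0 := hNpos.ne'
      have hLne : (L : ℝ) ≠ 0 := hL.ne'
      have hfac : ∀ (A x Rr : ℝ), Rr ≠ 0 → A ≠ 0 → (A / (4 * Rr)) ^ 2 * (4 * |x| / A) ^ 2 = (x / Rr) ^ 2 := by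
        intro A x Rr hRr hA
        rw [← mul_pow, show A / (4 * Rr) * (4 * |x| / A) = |x| / Rr by field_simp, div_pow, sq_abs, ← div_pow]
      rw [hc₀, hcX, hfac _ _ _ hR0r.ne' hNne, hfac _ _ _ hRr.ne' hLne, hfac _ _ _ hRr.ne' hLne, mul_assoc]
    simp_rw [hrw]
    rw [sum_sum_inv_prodWeight_eq_mul (fun a : TorusSite 1 N => 1 + (((a 0).valMinAbs : ℝ) / R₀) ^ 2)
      (fun b : TorusSite 2 L => (1 + (((b l).valMinAbs : ℝ) / R) ^ 2) * (1 + (((b l').valMinAbs : ℝ) / R) ^ 2))]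
    have hT : ∑ a : TorusSite 1 N, (1 + (((a 0).valMinAbs : ℝ) / R₀) ^ 2)⁻¹ ≤ 6 * (R₀ : ℝ) := by
      have h := sum_inv_one_add_valMinAbs_div_sq_le (L := N) hR₀
      simp_rw [one_div] at h
      have he : ∑ a : TorusSite 1 N, (1 + (((a 0).valMinAbs : ℝ) / R₀) ^ 2)⁻¹ =
          ∑ x : ZMod N, (1 + ((x.valMinAbs : ℝ) / R₀) ^ 2)⁻¹ := by
        refine Fintype.sum_equiv (Equiv.funUnique (Fin 1) (ZMod N)) _ _ fun a => ?_
        simp [Equiv.funUnique]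
      rw [he]; exact h
    -- the space factor: `{l, l'} = {0, 1}`
    have hX : ∑ b : TorusSite 2 L, ((1 + (((b l).valMinAbs : ℝ) / R) ^ 2) * (1 + (((b l').valMinAbs : ℝ) / R) ^ 2))⁻¹ ≤
        36 * (R : ℝ) ^ 2 := by
      have h := sum_prod_inv_one_add_valMinAbs_div_sq_le (L := L) hR
      refine le_trans (le_of_eq (sum_congr rfl fun b _ => ?_)) h
      rw [hprod b, ← Finset.prod_inv_distrib]
    have hT0 : 0 ≤ ∑ a : TorusSite 1 N, (1 + (((a 0).valMinAbs : ℝ) / R₀) ^ 2)⁻¹ := sum_nonneg fun a _ => by positivity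
    calc (∑ a : TorusSite 1 N, (1 + (((a 0).valMinAbs : ℝ) / R₀) ^ 2)⁻¹) *
          ∑ b : TorusSite 2 L, ((1 + (((b l).valMinAbs : ℝ) / R) ^ 2) * (1 + (((b l').valMinAbs : ℝ) / R) ^ 2))⁻¹
        ≤ (6 * (R₀ : ℝ)) * (36 * (R : ℝ) ^ 2) := mul_le_mul hT hX (sum_nonneg fun b _ => by positivity) (by positivity)
      _ = 216 * R₀ * (R : ℝ) ^ 2 := by ring
  · -- the eight mixed `ℓ²` norms
    refine Real.sqrt_le_sqrt ?_
    rw [show (N : ℝ) * (L : ℝ) ^ 2 = (N : ℝ) / (L : ℝ) ^ 2 * (L : ℝ) ^ 4 by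
      rw [div_mul_eq_mul_div, eq_div_iff (by positivity)]; ring, mul_assoc]
    refine mul_le_mul_of_nonneg_left ?_ (by positivity)
    rw [mul_sum]
    refine sum_le_sum fun e _ => ?_
    have he1 : (e.1 : ℕ) ≤ 1 := Nat.lt_succ_iff.1 e.1.isLt
    have he21 : (e.2.1 : ℕ) ≤ 1 := Nat.lt_succ_iff.1 e.2.1.isLt
    have he22 : (e.2.2 : ℕ) ≤ 1 := Nat.lt_succ_iff.1 e.2.2.isLt
    have hq := hS ((e.1 : ℕ) * 1) (1 + (e.2.1 : ℕ) * 1) ((e.2.2 : ℕ) * 1) (by omega) (by omega) (by omega) (by omega)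
    have hK0 := hKq (e.1 : ℕ) (1 + (e.2.1 : ℕ) + (e.2.2 : ℕ))
    simp only [mul_one] at hq
    calc (L : ℝ) ^ 4 * (c₀ ^ (e.1 : ℕ) * cX ^ (e.2.1 : ℕ) * cX ^ (e.2.2 : ℕ) *
          ∑ p : TorusSite 1 N, ∑ p' : TorusSite 2 L,
            ‖(fwdDiff (fun _ : Fin 1 => (1 : ZMod N)))^[(e.1 : ℕ)]
              (fun q => ((fwdDiff (Pi.single l (1 : ZMod L) : TorusSite 2 L))^[1 + (e.2.1 : ℕ)]
                ((fwdDiff (Pi.single l' (1 : ZMod L) : TorusSite 2 L))^[(e.2.2 : ℕ)] (P q))) p') p‖ ^ 2)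
        ≤ (L : ℝ) ^ 4 * (c₀ ^ (e.1 : ℕ) * cX ^ (e.2.1 : ℕ) * cX ^ (e.2.2 : ℕ) *
          (Kq (e.1 : ℕ) (1 + (e.2.1 : ℕ) + (e.2.2 : ℕ)) /
            ((L : ℝ) ^ (2 * (1 + (e.2.1 : ℕ) + (e.2.2 : ℕ)) + 2) * β ^ (2 * (e.1 : ℕ) + 1)))) := by
          gcongr
      _ = c₀ ^ (e.1 : ℕ) * ((1 / (4 * (R : ℝ))) ^ 2) ^ ((e.2.1 : ℕ) + (e.2.2 : ℕ)) *
          (Kq (e.1 : ℕ) (1 + (e.2.1 : ℕ) + (e.2.2 : ℕ)) / β ^ (2 * (e.1 : ℕ) + 1)) := by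
          obtain ⟨e0, e1, e2⟩ := e
          fin_cases e0 <;> fin_cases e1 <;> fin_cases e2 <;> simp [hcX] <;> field_simp

/-- **The first space moment of a piece is `O(1)` in the grid units, from the orders `a ≤ 2`, `b ≤ 1` only** (`2 ≤ β`, `0 < Λ`, `β³ ≤ M`, `2M ≤ N`, `R ≥ 1`):
`(β/N)·Σ_{a,b⃗} |b̃_l|·‖S[P](a,b⃗)‖ ≤ uvSpaceMomentConst Λ R Kq` — choose `R₀ = ⌈N/(βΛ)⌉`: then `(N/(4R₀))²/β² ≤ (Λ/4)²`,
`R₀ ≤ N/(βΛ) + 1`, `β/N ≤ 1/2`, and every `L` cancels. [cite: BenfattoGiulianiMastropietro2006, §2.8 (2.80)–(2.81)] -/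
theorem spaceMoment_charSum_piece_le_of_orders (hβ2 : 2 ≤ β) (hΛ : 0 < Λ) (hβM : β ^ 3 ≤ (M : ℝ)) (hMN : 2 * M ≤ N)
    (P : TorusSite 1 N → TorusSite 2 L → ℂ) (Kq : ℕ → ℕ → ℝ) (hKq : ∀ t k, 0 ≤ Kq t k) {l l' : Fin 2} (hll' : l ≠ l')
    (hS : ∀ (t a b : ℕ), t ≤ 1 → 1 ≤ a + b → a ≤ 2 → b ≤ 1 →
      ∑ p : TorusSite 1 N, ∑ p' : TorusSite 2 L,
          ‖(fwdDiff (fun _ : Fin 1 => (1 : ZMod N)))^[t]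
            (fun q => (fwdDiff (Pi.single l (1 : ZMod L) : TorusSite 2 L))^[a]
              ((fwdDiff (Pi.single l' (1 : ZMod L) : TorusSite 2 L))^[b] (P q)) p') p‖ ^ 2 ≤
        Kq t (a + b) / ((L : ℝ) ^ (2 * (a + b) + 2) * β ^ (2 * t + 1)))
    {R : ℕ} (hR : 1 ≤ R) :
    β / N * ∑ a : TorusSite 1 N, ∑ bv : TorusSite 2 L,
        |(((bv l).valMinAbs : ℤ) : ℝ)| * ‖∑ q₀ : TorusSite 1 N, ∑ qv : TorusSite 2 L, torusChar q₀ a * torusChar qv bv * P q₀ qv‖ ≤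
      uvSpaceMomentConst Λ R Kq := by
  obtain ⟨hβ0, hM1, h8, hMN'⟩ := thresholds_aux hβ2 hβM hMN
  have hL : (0 : ℝ) < L := by exact_mod_cast Nat.pos_of_ne_zero (NeZero.ne L)
  have hNpos : (0 : ℝ) < N := by exact_mod_cast Nat.pos_of_ne_zero (NeZero.ne N)
  have hRr : (0 : ℝ) < R := by exact_mod_cast hR
  -- `β/N ≤ 1/2`
  have hβN : β / N ≤ 1 / 2 := by
    rw [div_le_iff₀ hNpos]
    have hβ3 : β ≤ β ^ 3 := by nlinarith [sq_nonneg β]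
    linarith
  -- the time scale
  set R₀ : ℕ := ⌈(N : ℝ) / (β * Λ)⌉₊ with hR₀
  have hR₀pos : (0 : ℝ) < (N : ℝ) / (β * Λ) := by positivity
  have hR₀1 : 1 ≤ R₀ := Nat.one_le_iff_ne_zero.2 (Nat.ceil_pos.2 hR₀pos).ne'
  have hR₀le : (N : ℝ) / (β * Λ) ≤ R₀ := Nat.le_ceil _
  have hR₀lt : (R₀ : ℝ) < (N : ℝ) / (β * Λ) + 1 := Nat.ceil_lt_add_one hR₀pos.le
  have hR₀r : (0 : ℝ) < R₀ := by exact_mod_cast hR₀1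
  have hT := sum_sum_spaceWeight_mul_norm_charSum_le_of_orders (L := L) hβ0 P Kq hKq hll' hS hR₀1 hR
  -- rewrite the left-hand side as `(β/N)·(L/4)·Σ Y‖S‖`
  have hlhs : β / N * ∑ a : TorusSite 1 N, ∑ bv : TorusSite 2 L,
      |(((bv l).valMinAbs : ℤ) : ℝ)| * ‖∑ q₀ : TorusSite 1 N, ∑ qv : TorusSite 2 L, torusChar q₀ a * torusChar qv bv * P q₀ qv‖ =
      β / N * ((L : ℝ) / 4) * ∑ a : TorusSite 1 N, ∑ bv : TorusSite 2 L,
        4 * |(((bv l).valMinAbs : ℤ) : ℝ)| / L *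
          ‖∑ q₀ : TorusSite 1 N, ∑ qv : TorusSite 2 L, torusChar q₀ a * torusChar qv bv * P q₀ qv‖ := by
    simp only [Finset.mul_sum]
    refine Finset.sum_congr rfl fun a _ => Finset.sum_congr rfl fun bv _ => ?_
    field_simp
  rw [hlhs]
  set KS := ∑ e : Fin 2 × Fin 2 × Fin 2, ((Λ / 4) ^ 2) ^ (e.1 : ℕ) * ((1 / (4 * (R : ℝ))) ^ 2) ^ ((e.2.1 : ℕ) + (e.2.2 : ℕ)) *
    Kq (e.1 : ℕ) (1 + (e.2.1 : ℕ) + (e.2.2 : ℕ)) with hKS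
  have hKS0 : 0 ≤ KS := sum_nonneg fun e _ => by have := hKq (e.1 : ℕ) (1 + (e.2.1 : ℕ) + (e.2.2 : ℕ)); positivity
  have hS2 : (N : ℝ) / (L : ℝ) ^ 2 * ∑ e : Fin 2 × Fin 2 × Fin 2,
      (((N : ℝ) / (4 * R₀)) ^ 2) ^ (e.1 : ℕ) * ((1 / (4 * (R : ℝ))) ^ 2) ^ ((e.2.1 : ℕ) + (e.2.2 : ℕ)) *
        (Kq (e.1 : ℕ) (1 + (e.2.1 : ℕ) + (e.2.2 : ℕ)) / β ^ (2 * (e.1 : ℕ) + 1)) ≤ (N : ℝ) / (L : ℝ) ^ 2 / β * KS := by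
    rw [hKS, mul_sum, mul_sum]
    refine sum_le_sum fun e _ => ?_
    have hK0 := hKq (e.1 : ℕ) (1 + (e.2.1 : ℕ) + (e.2.2 : ℕ))
    have hc : ((N : ℝ) / (4 * R₀)) ^ 2 / β ^ 2 ≤ (Λ / 4) ^ 2 := by
      rw [← div_pow, div_div]
      refine pow_le_pow_left₀ (by positivity) ?_ 2
      rw [div_le_div_iff₀ (by positivity) (by norm_num)]
      have : (N : ℝ) ≤ R₀ * (β * Λ) := by rwa [div_le_iff₀ (by positivity)] at hR₀le
      nlinarith
    have heq : (N : ℝ) / (L : ℝ) ^ 2 * ((((N : ℝ) / (4 * R₀)) ^ 2) ^ (e.1 : ℕ) * ((1 / (4 * (R : ℝ))) ^ 2) ^ ((e.2.1 : ℕ) + (e.2.2 : ℕ)) *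
        (Kq (e.1 : ℕ) (1 + (e.2.1 : ℕ) + (e.2.2 : ℕ)) / β ^ (2 * (e.1 : ℕ) + 1))) =
        (N : ℝ) / (L : ℝ) ^ 2 / β * ((((N : ℝ) / (4 * R₀)) ^ 2 / β ^ 2) ^ (e.1 : ℕ) *
          ((1 / (4 * (R : ℝ))) ^ 2) ^ ((e.2.1 : ℕ) + (e.2.2 : ℕ)) * Kq (e.1 : ℕ) (1 + (e.2.1 : ℕ) + (e.2.2 : ℕ))) := by
      have hb : β ^ (2 * (e.1 : ℕ) + 1) = (β ^ 2) ^ (e.1 : ℕ) * β := by rw [pow_add, pow_mul, pow_one]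
      rw [hb, div_pow _ (β ^ 2)]
      field_simp
    rw [heq]
    refine mul_le_mul_of_nonneg_left ?_ (by positivity)
    gcongr
  have hS1 : 216 * (R₀ : ℝ) * (R : ℝ) ^ 2 ≤ 216 * (R : ℝ) ^ 2 * ((N : ℝ) / (β * Λ) + 1) := by nlinarith [hR₀lt.le]
  have hsq := mul_le_mul (Real.sqrt_le_sqrt hS1) (Real.sqrt_le_sqrt hS2) (Real.sqrt_nonneg _) (Real.sqrt_nonneg _)
  have hfin : β / N * ((L : ℝ) / 4) * (Real.sqrt (216 * (R : ℝ) ^ 2 * ((N : ℝ) / (β * Λ) + 1)) *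
      Real.sqrt ((N : ℝ) / (L : ℝ) ^ 2 / β * KS)) ≤ uvSpaceMomentConst Λ R Kq := by
    set A : ℝ := 216 * (R : ℝ) ^ 2 * ((N : ℝ) / (β * Λ) + 1) with hAdef
    set C : ℝ := 216 * (R : ℝ) ^ 2 * (1 / Λ + β / N) with hCdef
    have hA0 : 0 ≤ A := by positivity
    have hAB : A * ((N : ℝ) / (L : ℝ) ^ 2 / β * KS) = ((N : ℝ) / (β * L)) ^ 2 * (C * KS) := by
      rw [hAdef, hCdef]; field_simp
    have h1 : β / N * ((L : ℝ) / 4) * (Real.sqrt A * Real.sqrt ((N : ℝ) / (L : ℝ) ^ 2 / β * KS)) =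
        1 / 4 * Real.sqrt C * Real.sqrt KS := by
      rw [← Real.sqrt_mul hA0, hAB, Real.sqrt_mul (sq_nonneg _), Real.sqrt_sq (by positivity), Real.sqrt_mul (by positivity)]
      field_simp
    rw [h1, uvSpaceMomentConst, ← hKS, hCdef]
    gcongr
  exact le_trans (mul_le_mul_of_nonneg_left (hT.trans hsq) (by positivity)) hfin

end Moment

end Literature.MathematicalPhysics.QuantumLattice
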